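import Mathlib

/-!
# Crux `RigidityForcesSymmetry.RigidMinimalRepr` (stmt-ValiantsHypothesis-4163), line `registered` —
# stub `stub_level1Comb` (level-1 cells meeting every permutation contain two in a line, and a third)

Route `ValiantsHypothesis/RigidityForcesSymmetry`, crux `RigidMinimalRepr`, skeleton
`Cruxes/RigidMinimalRepr/Lines/registered.lean` (run by the lead as a refutation of the crux in the tight case of
the torus bound), stub `stub_level1Comb`: a self-contained combinatorial lemma about cells of an `m × m` board.

**Statement.** Let `m ≥ 3` and let `S ⊆ [m] × [m]` be a set of cells meeting the graph `{(k, σ k)}` of every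
permutation `σ` of `[m]`.  Then `S` contains three distinct cells `u₁, u₂, u₃` with `u₁, u₂` in a common row
(`u₁.1 = u₂.1`) or in a common column (`u₁.2 = u₂.2`).

**Proof.** Let `D = {k | (k, k) ∈ S}` (nonempty: serve `σ = 1`) and let `T = D ∪ {k'}` for some `k'` with
`(k', k') ∉ S` if there is one, `T = D = [m]` otherwise; either way `T` has two elements, contains `D`, and at
most one element of `T` lies outside `D`.  Take a permutation `f` cycling `T` and fixing its complement
(`Finset.exists_cycleOn`) and serve it: `(k, f k) ∈ S`.  Then `k ∈ T` (otherwise `f k = k`, so `k ∈ D ⊆ T`), hence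
`f k ≠ k` (`Equiv.Perm.IsCycleOn.apply_ne`) and `f k ∈ T`.  If `(k, k) ∈ S` the cells `(k, k), (k, f k)` share
row `k`; otherwise `f k ∈ D`, and `(f k, f k), (k, f k)` share column `f k`.  Third cell: for two cells in row `k`
with columns `l₁, l₂` pick `l₃ ∉ {l₁, l₂}` (`m ≥ 3`) and serve the transposition `swap k l₃`, which maps `k ↦ l₃`;
the served cell `(k'', swap k l₃ k'')` is `(k, l₃)` if `k'' = k` and lies in another row otherwise.  For two cells
in column `l` with rows `k₁, k₂` pick `k₃ ∉ {k₁, k₂}` and serve `swap k₃ l`; the served cell has column `l` only if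
its row is `k₃` (injectivity of the transposition).
-/

set_option autoImplicit false

-- the mandated summit-side namespace repeats a component by design (single-problem summit)
set_option linter.dupNamespace false

namespace Summit.ValiantsHypothesis.ValiantsHypothesis.Theorems.RigidityForcesSymmetryRigidMinimalRepr

namespace LevelOneComb

variable {m : ℕ}

/-- In `Fin m` with `m ≥ 3`, any two elements miss a third. -/
theorem levelOneComb_exists_ne_ne (hm : 3 ≤ m) (a b : Fin m) : ∃ c : Fin m, c ≠ a ∧ c ≠ b := by
  have h : 1 < (Finset.univ.erase a).card := by
    rw [Finset.card_erase_of_mem (Finset.mem_univ a), Finset.card_univ, Fintype.card_fin]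
    omega
  obtain ⟨c, hc, hcb⟩ := Finset.exists_mem_ne h b
  exact ⟨c, Finset.ne_of_mem_erase hc, hcb⟩

/-- **Two cells in a line.** If `S` meets the graph of every permutation and `T` is a finset with two elements
containing every `k` with `(k, k) ∈ S` and at most one `k` with `(k, k) ∉ S`, then `S` has two distinct cells in a
common row or column: serve a permutation cycling `T` and fixing its complement. -/
theorem levelOneComb_two_in_line (S : Set (Fin m × Fin m))
    (hS : ∀ σ : Equiv.Perm (Fin m), ∃ k, (k, σ k) ∈ S) (T : Finset (Fin m)) (hT : T.Nontrivial)
    (hDT : ∀ k, (k, k) ∈ S → k ∈ T) (hTD : ∀ j ∈ T, ∀ k ∈ T, j ≠ k → (k, k) ∉ S → (j, j) ∈ S) :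
    ∃ u₁ ∈ S, ∃ u₂ ∈ S, u₁ ≠ u₂ ∧ (u₁.1 = u₂.1 ∨ u₁.2 = u₂.2) := by
  obtain ⟨f, hf, hfT⟩ := T.exists_cycleOn
  obtain ⟨k, hk⟩ := hS f
  have hkT : k ∈ T := by
    by_contra hkT
    have hfix : f k = k := Equiv.Perm.notMem_support.1 fun h => hkT (hfT h)
    rw [hfix] at hk
    exact hkT (hDT k hk)
  have hfk : f k ≠ k := hf.apply_ne hT.coe (Finset.mem_coe.2 hkT)
  have hfkT : f k ∈ T := Finset.mem_coe.1 (hf.apply_mem_iff.2 (Finset.mem_coe.2 hkT))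
  by_cases hkk : (k, k) ∈ S
  · -- `(k, k)` and `(k, f k)` share row `k`
    exact ⟨(k, k), hkk, (k, f k), hk, fun h => hfk (congrArg Prod.snd h).symm, Or.inl rfl⟩
  · -- `k` is the one element of `T` off `D`, so `f k ∈ D`: `(f k, f k)` and `(k, f k)` share column `f k`
    exact ⟨(f k, f k), hTD (f k) hfkT k hkT hfk hkk, (k, f k), hk, fun h => hfk (congrArg Prod.fst h),
      Or.inr rfl⟩

/-- **A third cell.** Two cells in a common row or column leave room (`m ≥ 3`) for a transposition whose served
cell differs from both. -/
theorem levelOneComb_third (hm : 3 ≤ m) (S : Set (Fin m × Fin m))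
    (hS : ∀ σ : Equiv.Perm (Fin m), ∃ k, (k, σ k) ∈ S) (u₁ u₂ : Fin m × Fin m)
    (hu : u₁.1 = u₂.1 ∨ u₁.2 = u₂.2) : ∃ u₃ ∈ S, u₁ ≠ u₃ ∧ u₂ ≠ u₃ := by
  rcases hu with hrow | hcol
  · -- common row `u₁.1 = u₂.1`: serve `swap u₁.1 l₃` with `l₃ ∉ {u₁.2, u₂.2}`
    obtain ⟨l₃, h₁, h₂⟩ := levelOneComb_exists_ne_ne hm u₁.2 u₂.2
    obtain ⟨k, hk⟩ := hS (Equiv.swap u₁.1 l₃)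
    refine ⟨_, hk, fun h => h₁ ?_, fun h => h₂ ?_⟩
    · have h1 : u₁.1 = k := congrArg Prod.fst h
      have h2 : u₁.2 = Equiv.swap u₁.1 l₃ k := congrArg Prod.snd h
      rw [h2, ← h1, Equiv.swap_apply_left]
    · have h1 : u₂.1 = k := congrArg Prod.fst h
      have h2 : u₂.2 = Equiv.swap u₁.1 l₃ k := congrArg Prod.snd h
      rw [h2, ← h1, ← hrow, Equiv.swap_apply_left]
  · -- common column `u₁.2 = u₂.2`: serve `swap k₃ u₁.2` with `k₃ ∉ {u₁.1, u₂.1}`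
    obtain ⟨k₃, h₁, h₂⟩ := levelOneComb_exists_ne_ne hm u₁.1 u₂.1
    obtain ⟨k, hk⟩ := hS (Equiv.swap k₃ u₁.2)
    refine ⟨_, hk, fun h => h₁ ?_, fun h => h₂ ?_⟩
    · have h1 : u₁.1 = k := congrArg Prod.fst h
      have h2 : u₁.2 = Equiv.swap k₃ u₁.2 k := congrArg Prod.snd h
      rw [h1]
      refine (Equiv.swap k₃ u₁.2).injective ?_
      rw [Equiv.swap_apply_left]
      exact h2
    · have h1 : u₂.1 = k := congrArg Prod.fst h
      have h2 : u₂.2 = Equiv.swap k₃ u₁.2 k := congrArg Prod.snd h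
      rw [h1]
      refine (Equiv.swap k₃ u₁.2).injective ?_
      rw [Equiv.swap_apply_left]
      exact hcol.trans h2

end LevelOneComb

/-- **Stub `stub_level1Comb` of line `registered` for crux `RigidMinimalRepr`**: for `m ≥ 3`, a set of cells of
the `m × m` board meeting the graph `{(k, σ k)}` of every permutation `σ` contains three distinct cells, two of
them in a common row or a common column. -/
theorem stub_level1Comb {m : ℕ} (hm : 3 ≤ m) (S : Set (Fin m × Fin m))
    (hS : ∀ σ : Equiv.Perm (Fin m), ∃ k, (k, σ k) ∈ S) :
    ∃ u₁ ∈ S, ∃ u₂ ∈ S, ∃ u₃ ∈ S, u₁ ≠ u₂ ∧ u₁ ≠ u₃ ∧ u₂ ≠ u₃ ∧ (u₁.1 = u₂.1 ∨ u₁.2 = u₂.2) := by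
  classical
  -- two distinct cells in a line
  obtain ⟨u₁, hu₁, u₂, hu₂, h₁₂, hline⟩ :
      ∃ u₁ ∈ S, ∃ u₂ ∈ S, u₁ ≠ u₂ ∧ (u₁.1 = u₂.1 ∨ u₁.2 = u₂.2) := by
    by_cases hall : ∀ k : Fin m, (k, k) ∈ S
    · -- every diagonal cell lies in `S`: cycle the whole of `[m]` (two elements since `m ≥ 3`)
      refine LevelOneComb.levelOneComb_two_in_line S hS Finset.univ ?_ (fun k _ => Finset.mem_univ k)
        fun _ _ k _ _ hk => (hk (hall k)).elim
      have h1 : 1 < (Finset.univ : Finset (Fin m)).card := by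
        rw [Finset.card_univ, Fintype.card_fin]
        omega
      exact Finset.one_lt_card_iff_nontrivial.1 h1
    · -- some diagonal cell `(k', k')` is missing: cycle `D ∪ {k'}`, `D` the diagonal cells of `S` (nonempty:
      -- serve the identity)
      obtain ⟨k', hk'⟩ := not_forall.1 hall
      obtain ⟨d, hd⟩ := hS (Equiv.refl _)
      have hd : (d, d) ∈ S := hd
      refine LevelOneComb.levelOneComb_two_in_line S hS
        (insert k' (Finset.univ.filter fun k => (k, k) ∈ S)) ?_ ?_ ?_
      · refine ⟨k', Finset.mem_insert_self _ _, d,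
          Finset.mem_insert_of_mem (Finset.mem_filter.2 ⟨Finset.mem_univ d, hd⟩), ?_⟩
        rintro rfl
        exact hk' hd
      · exact fun k hk => Finset.mem_insert_of_mem (Finset.mem_filter.2 ⟨Finset.mem_univ k, hk⟩)
      · intro j hj k hk hjk hkk
        rcases Finset.mem_insert.1 hk with rfl | hkD
        · rcases Finset.mem_insert.1 hj with rfl | hjD
          · exact (hjk rfl).elim
          · exact (Finset.mem_filter.1 hjD).2
        · exact (hkk (Finset.mem_filter.1 hkD).2).elim
  -- and a third one
  obtain ⟨u₃, hu₃, h₁₃, h₂₃⟩ := LevelOneComb.levelOneComb_third hm S hS u₁ u₂ hline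
  exact ⟨u₁, hu₁, u₂, hu₂, u₃, hu₃, h₁₂, h₁₃, h₂₃, hline⟩

end Summit.ValiantsHypothesis.ValiantsHypothesis.Theorems.RigidityForcesSymmetryRigidMinimalRepr
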